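import Literature.IUT.HodgeTheaters.TemperedCoveringsCor23viHatCuspIncidenceDoublyBound
import Literature.IUT.HodgeTheaters.TemperedCoveringsCor23viHatCuspIncidenceTwoCusps
import Literature.IUT.HodgeTheaters.TemperedCoveringsCor23viHatCuspIncidencePositiveGenus
import Literature.AnabelianGeometry.SemiGraphs.MorphismsOver
import HarnessLib

/-!
# [IUTchI] Cor. 2.3 (vi): the cusp form `hFcusp` of the pro-`Σ̂` edge–subgraph incidence at a single-vertex `ℍ` is a
# THEOREM for semi-graphs of anabelioids of surface type with LOCALLY ANCHORED cusp vertices (assembly)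

S. Mochizuki, *Inter-universal Teichmüller theory I*, kurims manuscript (May 2020), §2, Cor. 2.3 (vi) p. 48 l. 6–16, proof
p. 49 l. 62–64 [cite: Mochizuki2012, Cor 2.3(vi) pp.48-49] (D-0012 claim key; series DISPUTED; nothing of it is asserted
here); S. Mochizuki, *Semi-graphs of anabelioids*, Publ. RIMS **42** (2006), §1 p. 11, Example 2.10 p. 31, Prop. 3.6 (iii)
p. 38 [cite: MochizukiSemiAnbd2006, Ex. 2.10 p.31].

PROOF-ONLY file (abc-iut cell, seat abc-iut-L5-d5 gen 10, row «COR23VI-HF-TWO-LEVEL@CAVEAT», assembly of the three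
local classes; cone row `IUTchI:Cor2.3(vi)` (discharged, RULINGS #118; residual `hF` = GAP-LEDGER G-w4d059-g8-1); no
definition, no instance, no notation, no `Prop` fact).  Consumed BY NAME: `DoublyBoundCusp.not_map_le_conj_closure_of_doublyBound`
(p514170), `TwoCusps.not_map_le_conj_closure_of_twoCusps` (p515093), `PositiveGenus.not_map_le_conj_closure_of_pos_genus`
(p515883), abc-iut-L3's `SemiGraph.exists_abuts_of_isConnected`.

**`LocalAnchors.hatCuspIncidence_singleVertex_of_localAnchors`** — abc-iut-w4-d059's binder `hFcusp` (the shape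
consumed by `hatCuspIncidence_of_openNormalSeparating` / `…_of_conjSeparating` / `…_of_twoLevelSeparating`) at
`ℍ = ⟨{w}, ∅⟩`, for EVERY chart, completion and `Π^tp_ℍ := TpH ∈ decompSubgroups c ⟨{w}, ∅⟩`, is PROVED for every
`𝒢 : ProfiniteSemiGraph` with the hypotheses of [SemiAnbd] Prop. 3.6 and the surface-type datum of Example 2.10 at every
vertex (`ℓ ∈ Σ`), PROVIDED every vertex `u ≠ w` carrying a cusp is LOCALLY ANCHORED: its surface datum has genus `≥ 1`, or
it carries a second cusp, or two of its edges reach `w` (`hanchor`, a combinatorial condition on the decorated dual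
semi-graph).  For an open edge `e`: if its abutting branch is at `w`, the conclusion of `hFcusp` holds; otherwise the
premise is refuted by the matching local theorem.  What is NOT covered (honest residual of G-w4d059-g8-1 at a single-vertex
`ℍ`): a genus-`0` vertex `u ≠ w` with exactly one cusp and at most one edge to `w` — there the compensating character
must live away from `u` (GAP-LEDGER D-G-w4d059-g8-1 route (C3): anchors exist by the stability count; needs path
combinatorics on `SemiGraph`).

BINDER CENSUS: LAW 0 · FACT 0 · ORIGIN 1 (the surface-type datum, ORIGIN only at the genuine `S.Gc`) · DATA: `hanchor`.
Nothing here bears on [IUTchIII] Cor. 3.12; typed ≠ inhabited ≠ discharged; nothing asserts that abc is proved or refuted.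
-/

noncomputable section

namespace Literature.IUT.HodgeTheaters

open _root_.Topology CategoryTheory
open scoped Pointwise
open Literature.AnabelianGeometry.SemiGraphs
open Literature.AnabelianGeometry.SemiGraphs.ProfiniteSemiGraph
open Literature.AnabelianGeometry.SemiGraphs.SemiGraphOfAnabelioids (IsProSigmaCompletion)
open Literature.GroupTheory.CombinatorialGroupTheory
open Literature.GroupTheory.CombinatorialGroupTheory.PuncturedSurfaceGroup
open DoublyBoundCusp

namespace LocalAnchors

variable {𝒢 : ProfiniteSemiGraph.{0}} {ℓ : ℕ} [hℓ : Fact ℓ.Prime]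

/-- **[IUTchI] Cor. 2.3 (vi): the cusp form `hFcusp` of the pro-`Σ̂` edge–subgraph incidence at `ℍ = ⟨{w}, ∅⟩ is a THEOREM
for every semi-graph of anabelioids of surface type all of whose cusp-carrying vertices `u ≠ w` are LOCALLY ANCHORED** —
i.e. have genus `≥ 1`, or carry a second cusp, or are joined to `w` by two edges.  Precisely: `𝒢 : ProfiniteSemiGraph`
with the hypotheses of [SemiAnbd] Prop. 3.6 and the surface-type datum of Example 2.10 at every vertex, `ℓ ∈ Σ` prime,
and `hanchor` the local-anchor alternative at every cusp of every `u ≠ w`; then for every chart `c`, completion `ι`,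
`Π^tp_ℍ := TpH ∈ decompSubgroups c ⟨{w}, ∅⟩`: for every OPEN edge `e`, every edge-like `L` at `e` and every `g`,
`ι(L) ⊆ g · closure ι(TpH) · g⁻¹` implies that `e` abuts `w` (abc-iut-w4-d059's binder `hFcusp`, by name in
`hatCuspIncidence_of_openNormalSeparating` / `…_of_conjSeparating`).  Dispatch to `PositiveGenus…`, `TwoCusps…`,
`DoublyBoundCusp…`. [cite: Mochizuki2012, Cor 2.3(vi) pp.48-49] [cite: MochizukiSemiAnbd2006, Ex. 2.10 p.31]
[claim: Mochizuki2012, status: disputed] -/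
theorem hatCuspIncidence_singleVertex_of_localAnchors (h36 : 𝒢.Prop36Hypotheses) {Sigma : Set ℕ} (hℓS : ℓ ∈ Sigma)
    (hv : ∀ v : 𝒢.graph.Vertex, ∃ (g r : ℕ) (ι : PuncturedSurfaceGroup g r →* 𝒢.Gv v),
      IsHyperbolicType g r ∧ IsProSigmaCompletion Sigma ι ∧
        ∃ js : 𝒢.graph.Star v → Fin r, Function.Injective js ∧
          ∀ b : 𝒢.graph.Star v, ∃ x : 𝒢.Gv v, 𝒢.branchSubgroup b.1 v b.2 =
            ConjAct.toConjAct x • ((cuspInertia (g := g) (js b)).map ι).topologicalClosure)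
    (w : 𝒢.graph.Vertex)
    (hanchor : ∀ (u : 𝒢.graph.Vertex) (be : 𝒢.graph.Star u), u ≠ w →
      (∀ b', 𝒢.graph.edgeOf b' = 𝒢.graph.edgeOf be.1 → b' ≠ be.1 → 𝒢.graph.abuts b' = none) →
      (∃ (g r : ℕ) (ι : PuncturedSurfaceGroup g r →* 𝒢.Gv u), 0 < g ∧ IsProSigmaCompletion Sigma ι ∧
          ∃ js : 𝒢.graph.Star u → Fin r, Function.Injective js ∧
            ∀ b : 𝒢.graph.Star u, ∃ x : 𝒢.Gv u, 𝒢.branchSubgroup b.1 u b.2 =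
              ConjAct.toConjAct x • ((cuspInertia (g := g) (js b)).map ι).topologicalClosure) ∨
      (∃ be₂ : 𝒢.graph.Star u, be₂ ≠ be ∧
          ∀ b', 𝒢.graph.edgeOf b' = 𝒢.graph.edgeOf be₂.1 → b' ≠ be₂.1 → 𝒢.graph.abuts b' = none) ∨
      (∃ b₁ b₂ : 𝒢.graph.Star u, b₁ ≠ b₂ ∧ ∃ b₁' b₂' : 𝒢.graph.Star w,
          𝒢.graph.edgeOf b₁'.1 = 𝒢.graph.edgeOf b₁.1 ∧ 𝒢.graph.edgeOf b₂'.1 = 𝒢.graph.edgeOf b₂.1))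
    (c : TemperedPiChart 𝒢) {Ghat : Type*} [Group Ghat] [TopologicalSpace Ghat] [IsTopologicalGroup Ghat]
    {ι : c.G →ₜ* Ghat} (hι : IsProfiniteCompletion ι) {TpH : Subgroup c.G}
    (hTpH : TpH ∈ c.decompSubgroups ⟨{w}, ∅⟩) :
    ∀ e : 𝒢.graph.Edge, (∃ b₀ : 𝒢.graph.Branch, 𝒢.graph.edgeOf b₀ = e ∧ 𝒢.graph.abuts b₀ = none) →
      ∀ L ∈ edgeLikeSubgroups c e, ∀ g : Ghat,
        L.map ι.toMonoidHom ≤ MulAut.conj g • (TpH.map ι.toMonoidHom).topologicalClosure →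
          ∃ b : 𝒢.graph.Branch, 𝒢.graph.edgeOf b = e ∧
            ∃ x ∈ (⟨{w}, ∅⟩ : 𝒢.graph.Subgraph).verts, 𝒢.graph.abuts b = some x := by
  intro e he₀ L hL g hle
  obtain ⟨b₀, hb₀e, hb₀⟩ := he₀
  -- the abutting branch of `e`
  obtain ⟨v₀⟩ := h36.hasVertex
  obtain ⟨b, hbe, hbs⟩ := SemiGraph.exists_abuts_of_isConnected h36.isConnected v₀ e
  obtain ⟨u, hb⟩ := Option.isSome_iff_exists.mp hbs
  subst hbe
  by_cases huw : u = w
  · subst huw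
    exact ⟨b, rfl, u, rfl, hb⟩
  exfalso
  -- the other branch of `e` is the open `b₀`
  have hbb₀ : b ≠ b₀ := fun h => by rw [h, hb₀] at hb; exact (Option.some_ne_none u) hb.symm
  have hopen : ∀ b', 𝒢.graph.edgeOf b' = 𝒢.graph.edgeOf b → b' ≠ b → 𝒢.graph.abuts b' = none := by
    intro b' hb' hne
    rcases eq_or_eq_of_edgeOf_eq hbb₀ hb₀e hb' with h | h
    · exact absurd h hne
    · rw [h, hb₀]
  rcases hanchor u ⟨b, hb⟩ huw hopen with hgen | ⟨be₂, hne₂, hopen₂⟩ | ⟨b₁, b₂, h₁₂, b₁', b₂', hf₁, hf₂⟩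
  · exact PositiveGenus.not_map_le_conj_closure_of_pos_genus h36 hℓS huw hgen ⟨b, hb⟩ hopen c hι hTpH hL g hle
  · obtain ⟨gu, ru, ιu, hh, hιu, jsu, hjsu, hbru⟩ := hv u
    exact TwoCusps.not_map_le_conj_closure_of_twoCusps h36 hℓS huw ⟨gu, ru, ιu, hh, hιu, jsu, hjsu, hbru⟩ ⟨b, hb⟩ be₂
      (Ne.symm hne₂) hopen hopen₂ c hι hTpH hL g hle
  · exact not_map_le_conj_closure_of_doublyBound h36 hℓS hv huw ⟨b, hb⟩ b₁ b₂ h₁₂ hopen b₁' b₂' hf₁ hf₂ c hι hTpH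
      hL g hle

end LocalAnchors

end Literature.IUT.HodgeTheaters
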